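import Mathlib
import Summits.Ventures.HodgeRepro2.T5MuInvariantPadic
import Summits.Ventures.HodgeRepro2.T5FiniteZerosCharacters
import Summits.Ventures.HodgeRepro2.T5PadicLinearTopology

/-!
# T5PushforwardMeasure — the push-forward of a measure along `Γ⁻ → Γ_𝔭`, «ν factors through Γ_𝔭»,
and S1 «μ(L⁻) = μ(L⁻_𝔭) ([P2]) ⇒ L⁻_𝔭 ≠ 0» with [P2] as the named hypothesis

Cell pub-hodge-repro2, Tier 5 support (seat p7; route/T5-CHECK-G-p7.md §3 S1 / S5 / S6, Q17). The
prose passes from the branch measure `L⁻_{Σ,λ⁻¹}` on `Γ⁻ ≅ ℤ_p^d` to its push-forward `L⁻_{Σ,λ⁻¹,𝔭}` on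
`Γ_𝔭 ≅ ℤ_p` («push-forward Q17, ν factors through Γ_𝔭»), and S1 reads [P2] (Hsieh's Theorem B):
«μ(L⁻_{Σ,λ⁻¹}) = μ(L⁻_{Σ,λ⁻¹,𝔭})», then «μ(φ) = ∞ ⟺ φ = 0». In the cell's measure model
(a measure = a bounded `R`-linear functional on `C(X, R)`; the μ-invariant of T5MuInvariantPadic):

* `pushforward π m`: `(π_* m)(ψ) := m(ψ ∘ π)` for `π : C(X, Y)`; bounded with the same bound
  (`norm_pushforward_le`), `∫ (ν ∘ π) dm = ∫ ν d(π_* m)` (`pushforward_apply`, «ν factors through Γ_𝔭»);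
* `mu_le_mu_pushforward`: `μ(m) ≤ μ(π_* m)` ALWAYS (the values of `π_* m` are among the values of `m`) —
  so the content of [P2] is exactly the reverse inequality;
* `pushforward_ne_zero_of_mu_eq`: if `μ(π_* m) = μ(m)` ([P2] as a hypothesis) and `m ≠ 0`, then
  `π_* m ≠ 0` — S1's «μ < ∞ ⇒ L⁻_𝔭 ≠ 0»;
* `finite_zeroSet_pushforward_of_mu_eq`: hence (T5FiniteZerosCharacters, `Y = ℤ_p`) only finitely
  many continuous characters `ν` of `ℤ_p` have `∫ν d(π_* m) = 0` — S1 + S5 in one statement, with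
  [P2] the only named hypothesis.

The model instance `R = ℤ_[p]` of T5FiniteZerosCharacters (every hypothesis holds — T5PadicLinearTopology)
is recorded here as an `example`. Not here: [P2] itself (a printed theorem about the Katz measure; here a
hypothesis). Mathlib + own files.
-/

namespace Summit.Ventures.HodgeRepro2.T5PushforwardMeasure

open PadicInt Filter Topology
open Summit.Ventures.HodgeRepro2

section General

variable {X Y : Type*} [TopologicalSpace X] [TopologicalSpace Y] [CompactSpace X] [CompactSpace Y]
variable {R : Type*} [NormedCommRing R]

/-- THE PUSH-FORWARD of a functional `m` on `C(X, R)` along `π : X → Y`: `(π_* m)(ψ) := m(ψ ∘ π)`. -/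
noncomputable def pushforward (π : C(X, Y)) (m : C(X, R) →ₗ[R] R) : C(Y, R) →ₗ[R] R :=
  m.comp (ContinuousMap.compRightAlgHom R R π).toLinearMap

omit [CompactSpace X] [CompactSpace Y] in
/-- `∫ ψ d(π_* m) = ∫ (ψ ∘ π) dm` («ν factors through Γ_𝔭»: integrating `ν = ν' ∘ π` against `m` is
integrating `ν'` against `π_* m`). -/
@[simp] theorem pushforward_apply (π : C(X, Y)) (m : C(X, R) →ₗ[R] R) (ψ : C(Y, R)) :
    pushforward π m ψ = m (ψ.comp π) := rfl

/-- `‖ψ ∘ π‖ ≤ ‖ψ‖`. -/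
theorem norm_comp_le (π : C(X, Y)) (ψ : C(Y, R)) : ‖ψ.comp π‖ ≤ ‖ψ‖ := by
  rw [ContinuousMap.norm_le _ (norm_nonneg _)]
  intro x
  exact ψ.norm_coe_le_norm (π x)

/-- The push-forward of a bounded functional is bounded with the same constant. -/
theorem norm_pushforward_le (π : C(X, Y)) (m : C(X, R) →ₗ[R] R) {C : ℝ} (hC : 0 ≤ C)
    (hm : ∀ φ, ‖m φ‖ ≤ C * ‖φ‖) (ψ : C(Y, R)) : ‖pushforward π m ψ‖ ≤ C * ‖ψ‖ := by
  rw [pushforward_apply]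
  calc ‖m (ψ.comp π)‖ ≤ C * ‖ψ.comp π‖ := hm _
    _ ≤ C * ‖ψ‖ := by gcongr; exact norm_comp_le π ψ

omit [CompactSpace X] [CompactSpace Y] in
/-- The push-forward of a continuous functional is continuous. -/
theorem continuous_pushforward (π : C(X, Y)) (m : C(X, R) →ₗ[R] R) (hm : Continuous m) :
    Continuous (pushforward π m) :=
  hm.comp (ContinuousMap.continuous_precomp π)

end General

section Mu

variable {p : ℕ} [hp : Fact p.Prime]
variable {X Y : Type*} [TopologicalSpace X] [TopologicalSpace Y] [CompactSpace X] [CompactSpace Y]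
  [T2Space X] [T2Space Y] [TotallyDisconnectedSpace X] [TotallyDisconnectedSpace Y]

/-- `μ(m) ≤ μ(π_* m)` for every bounded `ℤ_p`-valued measure `m` on a profinite `X` and every continuous
`π : X → Y`: the values `(π_* m)(ψ) = m(ψ ∘ π)` are among the values of `m`, so the infimum of their
valuations is at least `μ(m)` (T5MuInvariantPadic's «μ = inf over C(X, ℤ_p)»). -/
theorem mu_le_mu_pushforward (π : C(X, Y)) (m : C(X, ℤ_[p]) →ₗ[ℤ_[p]] ℤ_[p]) {C : ℝ} (hC : 0 ≤ C)
    (hm : ∀ φ, ‖m φ‖ ≤ C * ‖φ‖) :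
    T5MuInvariantPadic.mu p m ≤ T5MuInvariantPadic.mu p (pushforward π m) := by
  rw [← T5MuInvariantPadic.iInf_vp_apply_eq_mu p m hC hm,
    ← T5MuInvariantPadic.iInf_vp_apply_eq_mu p (pushforward π m) hC (norm_pushforward_le π m hC hm)]
  refine le_iInf_iff.mpr fun ψ => ?_
  rw [pushforward_apply]
  exact iInf_le (fun φ : C(X, ℤ_[p]) => T5MuInvariantPadic.vp p (m φ)) (ψ.comp π)

/-- S1, with [P2] as the hypothesis: if `μ(π_* m) = μ(m)` and `m ≠ 0`, then `π_* m ≠ 0`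
(`μ(m) < ∞` since `m ≠ 0`, so `μ(π_* m) < ∞`, so `π_* m ≠ 0` — T5MuInvariantPadic's
«μ(φ) = ∞ ⟺ φ = 0» on both spaces). -/
theorem pushforward_ne_zero_of_mu_eq (π : C(X, Y)) (m : C(X, ℤ_[p]) →ₗ[ℤ_[p]] ℤ_[p]) {C : ℝ}
    (hC : 0 ≤ C) (hm : ∀ φ, ‖m φ‖ ≤ C * ‖φ‖) (hne : m ≠ 0)
    (hP2 : T5MuInvariantPadic.mu p (pushforward π m) = T5MuInvariantPadic.mu p m) :
    pushforward π m ≠ 0 := by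
  intro h0
  apply hne
  rw [← T5MuInvariantPadic.mu_eq_top_iff_eq_zero p m hC hm, ← hP2,
    T5MuInvariantPadic.mu_eq_top_iff_eq_zero p (pushforward π m) hC (norm_pushforward_le π m hC hm)]
  exact h0

end Mu

section Padic

variable {p : ℕ} [hp : Fact p.Prime]

/-- MODEL INSTANCE of T5FiniteZerosCharacters: for `R = ℤ_[p]` every hypothesis is satisfied
(T5PadicLinearTopology), so a non-zero continuous `ℤ_p`-linear functional on `C(ℤ_p, ℤ_p)` kills only
finitely many continuous characters. -/
example (m : C(ℤ_[p], ℤ_[p]) →ₗ[ℤ_[p]] ℤ_[p]) (hm : Continuous m) (hne : m ≠ 0) :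
    {κ : {κ : AddChar ℤ_[p] ℤ_[p] // Continuous κ} | m ⟨κ.1, κ.2⟩ = 0}.Finite :=
  T5FiniteZerosCharacters.finite_zeroSet_addChar m hm hne

variable {X : Type*} [TopologicalSpace X] [CompactSpace X] [T2Space X] [TotallyDisconnectedSpace X]

/-- S1 + S5 in one statement, [P2] the only named hypothesis: for a bounded `ℤ_p`-valued measure
`m ≠ 0` on a profinite `X` («Γ⁻») and a continuous `π : X → ℤ_p` («Γ⁻ → Γ_𝔭 ≅ ℤ_p») with
`μ(π_* m) = μ(m)`, only finitely many continuous characters `ν` of `ℤ_p` have `∫ν d(π_* m) = 0`. -/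
theorem finite_zeroSet_pushforward_of_mu_eq (π : C(X, ℤ_[p])) (m : C(X, ℤ_[p]) →ₗ[ℤ_[p]] ℤ_[p])
    {C : ℝ} (hC : 0 ≤ C) (hm : ∀ φ, ‖m φ‖ ≤ C * ‖φ‖) (hne : m ≠ 0)
    (hP2 : T5MuInvariantPadic.mu p (pushforward π m) = T5MuInvariantPadic.mu p m) :
    {κ : {κ : AddChar ℤ_[p] ℤ_[p] // Continuous κ} | pushforward π m ⟨κ.1, κ.2⟩ = 0}.Finite :=
  T5FiniteZerosCharacters.finite_zeroSet_addChar (pushforward π m)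
    (T5AmiceTransform.continuous_of_bound _ C (norm_pushforward_le π m hC hm))
    (pushforward_ne_zero_of_mu_eq π m hC hm hne hP2)

end Padic

end Summit.Ventures.HodgeRepro2.T5PushforwardMeasure
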